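import Mathlib
import HarnessLib
import Literature.MathematicalPhysics.StatisticalMechanics.MuGSC
import Literature.MathematicalPhysics.StatisticalMechanics.LennardJonesClusters

/-!
# OverbindingBudget — packing in boxes and tails of Lennard-Jones fields (tools for `CubeChargeLaw`)

Self-contained tools for the `CubeChargeLaw` line «Bookkeeping» of route `OverbindingBudget`
(stmt-AtomisticToContinuum-30251) and for the engine of the `RobustDefectLimitWindows` line «Coercivity»:

* packing of `δ`-separated sets in boxes and slabs of `ℝ³` (grid-cell injection; `card_le_of_separated_of_box`,
  `card_slab_le`);
* dyadic shell counting: for `T ⊆ ℝ³` with pairwise distances `≥ δ` and all points at distance `≥ ρ ≥ δ` from `p`,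
  `|∑_{z ∈ T} V_LJ(|p − z|)| ≤ 432 (δ⁻⁶ + 1) δ⁻³ ρ⁻³` (`abs_tsum_lennardJones_le_dyadic`; packing input
  `card_le_of_separated_of_dist_le`).
-/

namespace Summit.AtomisticToContinuum.Crystallization.Theorems.OverbindingBudgetCubeTails

open Literature.MathematicalPhysics.StatisticalMechanics

/-! ## Packing in boxes -/

/-- Two nonnegative reals in the same half-`δ` grid cell differ by less than `δ/2`. [folklore] -/
theorem abs_sub_lt_of_floor_eq {δ u v : ℝ} (hδ : 0 < δ) (hu : 0 ≤ u) (hv : 0 ≤ v)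
    (h : ⌊2 * u / δ⌋₊ = ⌊2 * v / δ⌋₊) : |u - v| < δ / 2 := by
  have h1 := Nat.floor_le (show 0 ≤ 2 * u / δ by positivity)
  have h2 := Nat.lt_floor_add_one (2 * u / δ)
  have h3 := Nat.floor_le (show 0 ≤ 2 * v / δ by positivity)
  have h4 := Nat.lt_floor_add_one (2 * v / δ)
  rw [h] at h1 h2
  have h5 : |2 * u / δ - 2 * v / δ| < 1 := by
    rw [abs_lt]; constructor <;> linarith
  have h6 : 2 * u / δ - 2 * v / δ = 2 * (u - v) / δ := by ring
  rw [h6, abs_div, abs_of_pos hδ, div_lt_one hδ, abs_mul, abs_of_pos (by norm_num : (0 : ℝ) < 2)] at h5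
  linarith

/-- **Packing in a box.** A `δ`-separated finite subset of the box `∏ᵢ [aᵢ, aᵢ + Lᵢ)` of `ℝ³` has at most
`∏ᵢ (2Lᵢ/δ + 1)` points: the map to the grid cell of side `δ/2` is injective (a cell has diameter `< δ`).
[folklore] -/
theorem card_le_of_separated_of_box (s : Finset (EuclideanSpace ℝ (Fin 3))) (a L : Fin 3 → ℝ) {δ : ℝ}
    (hδ : 0 < δ) (hL : ∀ i, 0 ≤ L i) (hs : ∀ z ∈ s, ∀ i, a i ≤ z i ∧ z i < a i + L i)
    (hsep : ∀ z ∈ s, ∀ w ∈ s, z ≠ w → δ ≤ dist z w) :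
    (s.card : ℝ) ≤ ∏ i, (2 * L i / δ + 1) := by
  classical
  set idx : EuclideanSpace ℝ (Fin 3) → (Fin 3 → ℕ) := fun z i => ⌊2 * (z i - a i) / δ⌋₊ with hidx
  set t : Finset (Fin 3 → ℕ) := Fintype.piFinset fun i => Finset.range (⌊2 * L i / δ⌋₊ + 1) with ht
  have hmaps : Set.MapsTo idx ↑s ↑t := by
    intro z hz
    rw [Finset.mem_coe, ht, Fintype.mem_piFinset]
    intro i
    rw [Finset.mem_range]
    have hzi := hs z hz i
    have hle : 2 * (z i - a i) / δ ≤ 2 * L i / δ := by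
      apply div_le_div_of_nonneg_right _ hδ.le
      linarith [hzi.2]
    exact Nat.lt_succ_of_le (Nat.floor_le_floor hle)
  have hinj : Set.InjOn idx ↑s := by
    intro z hz w hw hzw
    by_contra hne
    have hd := hsep z hz w hw hne
    have hc : ∀ i, |z i - w i| < δ / 2 := by
      intro i
      have hi : idx z i = idx w i := by rw [hzw]
      have key := abs_sub_lt_of_floor_eq hδ (sub_nonneg.2 (hs z hz i).1) (sub_nonneg.2 (hs w hw i).1) hi
      rwa [show z i - a i - (w i - a i) = z i - w i by ring] at key
    have hlt : dist z w < δ := by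
      rw [EuclideanSpace.dist_eq, Real.sqrt_lt' hδ]
      have h3 : ∀ i, dist (z i) (w i) ^ 2 < (δ / 2) ^ 2 := by
        intro i
        rw [Real.dist_eq]
        have h0 := abs_nonneg (z i - w i)
        have h1 := hc i
        nlinarith
      calc ∑ i, dist (z i) (w i) ^ 2 < ∑ _i : Fin 3, (δ / 2) ^ 2 :=
            Finset.sum_lt_sum_of_nonempty Finset.univ_nonempty (fun i _ => h3 i)
        _ = 3 * (δ / 2) ^ 2 := by simp
        _ < δ ^ 2 := by nlinarith
    linarith
  have hcard := Finset.card_le_card_of_injOn idx hmaps hinj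
  rw [ht, Fintype.card_piFinset] at hcard
  simp only [Finset.card_range] at hcard
  have hcast : ((∏ i, (⌊2 * L i / δ⌋₊ + 1) : ℕ) : ℝ) = ∏ i, ((⌊2 * L i / δ⌋₊ : ℝ) + 1) := by
    push_cast
    rfl
  calc (s.card : ℝ) ≤ ((∏ i, (⌊2 * L i / δ⌋₊ + 1) : ℕ) : ℝ) := by exact_mod_cast hcard
    _ = ∏ i, ((⌊2 * L i / δ⌋₊ : ℝ) + 1) := hcast
    _ ≤ ∏ i, (2 * L i / δ + 1) := by
        apply Finset.prod_le_prod
        · intro i _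
          positivity
        · intro i _
          have hLi := hL i
          have := Nat.floor_le (show 0 ≤ 2 * L i / δ by positivity)
          linarith

/-- **Packing in a slab.** Points of a `δ`-separated finite set inside the cube `Q(c, ℓ)` whose `i₀`-th
coordinate lies in a window `[m, m + R)` number at most `(2R/δ + 1)(2ℓ/δ + 1)²`. [folklore] -/
theorem card_slab_le (s : Finset (EuclideanSpace ℝ (Fin 3))) (c : EuclideanSpace ℝ (Fin 3)) (ℓ R m : ℝ) (i₀ : Fin 3) {δ : ℝ}
    (hδ : 0 < δ) (hℓ : 0 ≤ ℓ) (hR : 0 ≤ R)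
    (hs : ∀ z ∈ s, ∀ i, c i ≤ z i ∧ z i < c i + ℓ) (hs₀ : ∀ z ∈ s, m ≤ z i₀ ∧ z i₀ < m + R)
    (hsep : ∀ z ∈ s, ∀ w ∈ s, z ≠ w → δ ≤ dist z w) :
    (s.card : ℝ) ≤ (2 * R / δ + 1) * (2 * ℓ / δ + 1) ^ 2 := by
  classical
  have h := card_le_of_separated_of_box s (Function.update (fun i => c i) i₀ m)
    (Function.update (fun _ => ℓ) i₀ R) hδ
    (fun i => by
      by_cases hi : i = i₀
      · subst hi; simp [hR]
      · simp [Function.update_of_ne hi, hℓ])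
    (fun z hz i => by
      by_cases hi : i = i₀
      · subst hi
        simp only [Function.update_self]
        exact hs₀ z hz
      · simp only [Function.update_of_ne hi]
        exact hs z hz i)
    hsep
  have hprod : ∏ i, (2 * Function.update (fun _ : Fin 3 => ℓ) i₀ R i / δ + 1) =
      (2 * R / δ + 1) * (2 * ℓ / δ + 1) ^ 2 := by
    rw [← Finset.mul_prod_erase Finset.univ _ (Finset.mem_univ i₀), Function.update_self]
    congr 1
    rw [Finset.prod_congr rfl (fun i hi => by rw [Function.update_of_ne (Finset.ne_of_mem_erase hi)]),
      Finset.prod_const, Finset.card_erase_of_mem (Finset.mem_univ _), Finset.card_univ, Fintype.card_fin]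
  rw [hprod] at h
  exact h

/-! ## Tails of Lennard-Jones fields: dyadic shell counting -/

/-- **Dyadic shell sum.** If the points of a finite `t ⊆ ℝ³` are pairwise `≥ δ > 0` apart and all at distance
`≥ ρ ≥ δ` from `p`, then `∑_{z ∈ t} |p − z|⁻⁶ ≤ 432 δ⁻³ ρ⁻³`: the dyadic shell `2ᵏρ ≤ |p − z| < 2ᵏ⁺¹ρ` holds at
most `(4·2ᵏρ/δ + 1)³ ≤ (6·2ᵏρ/δ)³` points (packing), each contributing `≤ (2ᵏρ)⁻⁶`, and `∑ₖ 2⁻ᵏ ≤ 2`.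
[folklore] -/
theorem sum_inv_pow_six_le_dyadic (t : Finset (EuclideanSpace ℝ (Fin 3))) (p : EuclideanSpace ℝ (Fin 3)) {δ ρ : ℝ}
    (hδ : 0 < δ) (hδρ : δ ≤ ρ) (hp : ∀ z ∈ t, ρ ≤ dist p z)
    (ht : ∀ z ∈ t, ∀ w ∈ t, z ≠ w → δ ≤ dist z w) :
    ∑ z ∈ t, (dist p z)⁻¹ ^ 6 ≤ 432 * δ⁻¹ ^ 3 * ρ⁻¹ ^ 3 := by
  classical
  have hρ : 0 < ρ := hδ.trans_le hδρ
  set kf : EuclideanSpace ℝ (Fin 3) → ℕ := fun z => Nat.log 2 ⌊dist p z / ρ⌋₊ with hkf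
  have hshell : ∀ z ∈ t, (2 : ℝ) ^ kf z * ρ ≤ dist p z ∧ dist p z < (2 : ℝ) ^ (kf z + 1) * ρ := by
    intro z hz
    have hd : 1 ≤ dist p z / ρ := (one_le_div hρ).2 (hp z hz)
    have hm1 : 1 ≤ ⌊dist p z / ρ⌋₊ := (Nat.one_le_floor_iff _).2 hd
    have hm0 : ⌊dist p z / ρ⌋₊ ≠ 0 := by omega
    have h1 : 2 ^ kf z ≤ ⌊dist p z / ρ⌋₊ := Nat.pow_log_le_self 2 hm0
    have h2 : ⌊dist p z / ρ⌋₊ < 2 ^ (kf z + 1) := Nat.lt_pow_succ_log_self (by norm_num) _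
    have h1' : (2 : ℝ) ^ kf z ≤ (⌊dist p z / ρ⌋₊ : ℝ) := by exact_mod_cast h1
    have h2' : (⌊dist p z / ρ⌋₊ : ℝ) + 1 ≤ (2 : ℝ) ^ (kf z + 1) := by exact_mod_cast h2
    have hfl := Nat.floor_le (show 0 ≤ dist p z / ρ by positivity)
    have hlt := Nat.lt_floor_add_one (dist p z / ρ)
    constructor
    · have h3 : (2 : ℝ) ^ kf z ≤ dist p z / ρ := h1'.trans hfl
      rwa [le_div_iff₀ hρ] at h3
    · have h3 : dist p z / ρ < (2 : ℝ) ^ (kf z + 1) := hlt.trans_le h2'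
      rwa [div_lt_iff₀ hρ] at h3
  have hfib : ∀ k : ℕ, ∑ z ∈ t.filter (fun z => kf z = k), (dist p z)⁻¹ ^ 6 ≤
      216 * δ⁻¹ ^ 3 * ρ⁻¹ ^ 3 * ((2 : ℝ) ^ k)⁻¹ := by
    intro k
    set s := t.filter (fun z => kf z = k) with hs
    have hs_t : ∀ z ∈ s, z ∈ t := fun z hz => (Finset.mem_filter.1 hz).1
    have hs_k : ∀ z ∈ s, kf z = k := fun z hz => (Finset.mem_filter.1 hz).2
    set a : ℝ := (2 : ℝ) ^ k with ha
    have ha1 : 1 ≤ a := one_le_pow₀ (by norm_num)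
    have ha0 : 0 < a := by positivity
    have hterm : ∀ z ∈ s, (dist p z)⁻¹ ^ 6 ≤ (a * ρ)⁻¹ ^ 6 := by
      intro z hz
      have h := (hshell z (hs_t z hz)).1
      rw [hs_k z hz] at h
      exact pow_le_pow_left₀ (inv_nonneg.2 dist_nonneg) (inv_anti₀ (by positivity) h) 6
    have hcard : (s.card : ℝ) ≤ (2 * (2 * a * ρ) / δ + 1) ^ 3 := by
      have h := card_le_of_separated_of_dist_le s p hδ (by positivity : (0 : ℝ) ≤ 2 * a * ρ)
        (fun z hz => by
          have h := (hshell z (hs_t z hz)).2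
          rw [hs_k z hz, pow_succ] at h
          rw [dist_comm]
          linarith)
        (fun z hz w hw hzw => ht z (hs_t z hz) w (hs_t w hw) hzw)
      rwa [finrank_euclideanSpace_fin] at h
    have haρδ : 1 ≤ a * ρ * δ⁻¹ := by
      rw [← div_eq_mul_inv, one_le_div hδ]
      nlinarith
    have hcard' : (s.card : ℝ) ≤ (6 * a * ρ * δ⁻¹) ^ 3 := by
      refine hcard.trans (pow_le_pow_left₀ (by positivity) ?_ 3)
      rw [div_eq_mul_inv]
      nlinarith
    have ha' : a ≠ 0 := ha0.ne'
    have hρ' : ρ ≠ 0 := hρ.ne'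
    have hδ' : δ ≠ 0 := hδ.ne'
    have hid : (6 * a * ρ * δ⁻¹) ^ 3 * (a * ρ)⁻¹ ^ 6 = 216 * δ⁻¹ ^ 3 * ρ⁻¹ ^ 3 * a⁻¹ ^ 3 := by
      field_simp
      ring
    have ha3 : a⁻¹ ^ 3 ≤ a⁻¹ :=
      pow_le_of_le_one (by positivity) (inv_le_one_of_one_le₀ ha1) (by norm_num)
    calc ∑ z ∈ s, (dist p z)⁻¹ ^ 6 ≤ ∑ z ∈ s, (a * ρ)⁻¹ ^ 6 := Finset.sum_le_sum hterm
      _ = s.card * (a * ρ)⁻¹ ^ 6 := by rw [Finset.sum_const, nsmul_eq_mul]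
      _ ≤ (6 * a * ρ * δ⁻¹) ^ 3 * (a * ρ)⁻¹ ^ 6 := mul_le_mul_of_nonneg_right hcard' (by positivity)
      _ = 216 * δ⁻¹ ^ 3 * ρ⁻¹ ^ 3 * a⁻¹ ^ 3 := hid
      _ ≤ 216 * δ⁻¹ ^ 3 * ρ⁻¹ ^ 3 * a⁻¹ := mul_le_mul_of_nonneg_left ha3 (by positivity)
  rw [← Finset.sum_fiberwise_of_maps_to (fun z hz => Finset.mem_image_of_mem kf hz)]
  calc ∑ k ∈ t.image kf, ∑ z ∈ t.filter (fun z => kf z = k), (dist p z)⁻¹ ^ 6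
      ≤ ∑ k ∈ t.image kf, 216 * δ⁻¹ ^ 3 * ρ⁻¹ ^ 3 * ((2 : ℝ) ^ k)⁻¹ :=
        Finset.sum_le_sum (fun k _ => hfib k)
    _ = 216 * δ⁻¹ ^ 3 * ρ⁻¹ ^ 3 * ∑ k ∈ t.image kf, ((1 : ℝ) / 2) ^ k := by
        rw [Finset.mul_sum]
        refine Finset.sum_congr rfl (fun k _ => ?_)
        simp only [one_div, inv_pow]
    _ ≤ 216 * δ⁻¹ ^ 3 * ρ⁻¹ ^ 3 * 2 := by
        apply mul_le_mul_of_nonneg_left _ (by positivity)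
        calc ∑ k ∈ t.image kf, ((1 : ℝ) / 2) ^ k ≤ ∑' k, ((1 : ℝ) / 2) ^ k :=
            summable_geometric_two.sum_le_tsum _ (fun k _ => by positivity)
          _ = 2 := tsum_geometric_two
    _ = 432 * δ⁻¹ ^ 3 * ρ⁻¹ ^ 3 := by ring

/-- `|V_LJ(t)| ≤ (δ⁻⁶ + 1) t⁻⁶` for `t ≥ δ > 0`. [folklore] -/
theorem abs_lennardJones_le_of_le {δ t : ℝ} (hδ : 0 < δ) (ht : δ ≤ t) :
    |lennardJones t| ≤ (δ⁻¹ ^ 6 + 1) * t⁻¹ ^ 6 := by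
  have h0 : 0 ≤ t⁻¹ := inv_nonneg.2 (hδ.le.trans ht)
  have h1 : t⁻¹ ≤ δ⁻¹ := inv_anti₀ hδ ht
  have h6 : t⁻¹ ^ 6 ≤ δ⁻¹ ^ 6 := pow_le_pow_left₀ h0 h1 6
  have h6' : 0 ≤ t⁻¹ ^ 6 := pow_nonneg h0 6
  have h12 : t⁻¹ ^ 12 = t⁻¹ ^ 6 * t⁻¹ ^ 6 := by ring
  unfold lennardJones
  rw [h12, abs_le]
  constructor <;> nlinarith [mul_le_mul_of_nonneg_right h6 h6', mul_nonneg h6' h6']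

/-- **Tail of the field, finite form.** `∑_{z ∈ t} |V_LJ(|p − z|)| ≤ 432 (δ⁻⁶ + 1) δ⁻³ ρ⁻³` under the
hypotheses of `sum_inv_pow_six_le_dyadic`. [folklore] -/
theorem sum_abs_lennardJones_le_dyadic (t : Finset (EuclideanSpace ℝ (Fin 3))) (p : EuclideanSpace ℝ (Fin 3)) {δ ρ : ℝ}
    (hδ : 0 < δ) (hδρ : δ ≤ ρ) (hp : ∀ z ∈ t, ρ ≤ dist p z)
    (ht : ∀ z ∈ t, ∀ w ∈ t, z ≠ w → δ ≤ dist z w) :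
    ∑ z ∈ t, |lennardJones (dist p z)| ≤ 432 * (δ⁻¹ ^ 6 + 1) * δ⁻¹ ^ 3 * ρ⁻¹ ^ 3 := by
  calc ∑ z ∈ t, |lennardJones (dist p z)| ≤ ∑ z ∈ t, (δ⁻¹ ^ 6 + 1) * (dist p z)⁻¹ ^ 6 :=
        Finset.sum_le_sum (fun z hz => abs_lennardJones_le_of_le hδ (hδρ.trans (hp z hz)))
    _ = (δ⁻¹ ^ 6 + 1) * ∑ z ∈ t, (dist p z)⁻¹ ^ 6 := (Finset.mul_sum _ _ _).symm
    _ ≤ (δ⁻¹ ^ 6 + 1) * (432 * δ⁻¹ ^ 3 * ρ⁻¹ ^ 3) :=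
        mul_le_mul_of_nonneg_left (sum_inv_pow_six_le_dyadic t p hδ hδρ hp ht) (by positivity)
    _ = 432 * (δ⁻¹ ^ 6 + 1) * δ⁻¹ ^ 3 * ρ⁻¹ ^ 3 := by ring

/-- **Tail of the field, `tsum` form.** For `T ⊆ ℝ³` with pairwise distances `≥ δ > 0` and all points at
distance `≥ ρ ≥ δ` from `p`: `|∑_{z ∈ T} V_LJ(|p − z|)| ≤ 432 (δ⁻⁶ + 1) δ⁻³ ρ⁻³`. [folklore] -/
theorem abs_tsum_lennardJones_le_dyadic {T : Set (EuclideanSpace ℝ (Fin 3))} (p : EuclideanSpace ℝ (Fin 3)) {δ ρ : ℝ}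
    (hδ : 0 < δ) (hδρ : δ ≤ ρ) (hp : ∀ z ∈ T, ρ ≤ dist p z)
    (hT : ∀ z ∈ T, ∀ w ∈ T, z ≠ w → δ ≤ dist z w) :
    |∑' z : T, lennardJones (dist p z)| ≤ 432 * (δ⁻¹ ^ 6 + 1) * δ⁻¹ ^ 3 * ρ⁻¹ ^ 3 := by
  classical
  have hfin : ∀ u : Finset T, ∑ z ∈ u, |lennardJones (dist p (z : EuclideanSpace ℝ (Fin 3)))| ≤
      432 * (δ⁻¹ ^ 6 + 1) * δ⁻¹ ^ 3 * ρ⁻¹ ^ 3 := by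
    intro u
    have h := sum_abs_lennardJones_le_dyadic (u.image Subtype.val) p hδ hδρ
      (fun z hz => by
        obtain ⟨y, -, rfl⟩ := Finset.mem_image.1 hz
        exact hp y y.2)
      (fun z hz w hw hzw => by
        obtain ⟨y, -, rfl⟩ := Finset.mem_image.1 hz
        obtain ⟨y', -, rfl⟩ := Finset.mem_image.1 hw
        exact hT y y.2 y' y'.2 hzw)
    rwa [Finset.sum_image (fun a _ b _ h => Subtype.val_injective h)] at h
  have habs : Summable fun z : T => |lennardJones (dist p (z : EuclideanSpace ℝ (Fin 3)))| :=
    summable_of_sum_le (fun z => abs_nonneg _) hfin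
  have hnorm : Summable fun z : T => ‖lennardJones (dist p (z : EuclideanSpace ℝ (Fin 3)))‖ := by
    simpa only [Real.norm_eq_abs] using habs
  calc |∑' z : T, lennardJones (dist p (z : EuclideanSpace ℝ (Fin 3)))|
      ≤ ∑' z : T, |lennardJones (dist p (z : EuclideanSpace ℝ (Fin 3)))| := by
        have h := norm_tsum_le_tsum_norm hnorm
        simpa only [Real.norm_eq_abs] using h
    _ ≤ 432 * (δ⁻¹ ^ 6 + 1) * δ⁻¹ ^ 3 * ρ⁻¹ ^ 3 := habs.tsum_le_of_sum_le hfin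

/-! ## The cross term -/

end Summit.AtomisticToContinuum.Crystallization.Theorems.OverbindingBudgetCubeTails
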